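import Summits.NavierStokesRegularity.NavierStokesRegularity.Theses.FilamentSkeletonRss
import Literature.Analysis.FluidPDE.GaussianVortexLinearLam

/-!
# `CoreGluingGivenInvertibility` (stmt-NavierStokesRegularity-17944) — negative lemma:
# the asymmetry range of the linear input is exactly the range of Gaussian cores

Route `FilamentSkeletonRss`, crux `CoreGluingGivenInvertibility := CoreLinearInvertibility → CoreGluing`
(disprover's file, lands with `--supports stmt-NavierStokesRegularity-17944`; theorems only).

The crux's NEW hypothesis `CoreLinearInvertibility` (stmt-17973) is an a-priori bound for the planar
core operator `T_{λ,R} = L_λ − RΛ_G`, `L_λ = strainedVorticityOperator λ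
= Δ + (1+λ)/2·x₀∂₀ + (1−λ)/2·x₁∂₁ + 1`, quantified over the asymmetry range `λ ∈ [0,1)` ONLY, in the
weight `gaussWeightLam λ = (1−λ)/(4π) e^{−(1−λ)|x|²/4}`.  The crux's informal dictionary sends filament `j`
of the skeleton (hypothesis `SkeletonEquilibrium`, stmt-15400) to the pair `(λ_j, R = Γγ_j)`, `λ_j` = the
asymmetry of the symmetric cross strain of the frame field at the stagnation point `τ*_j`.  Nothing in
`SkeletonEquilibrium` bounds `λ_j`, and at every certified supercritical skeleton on record the cross strain
is HYPERBOLIC: `λ = 2.16` for the 2001 `C₃` triple, `λ = 1.17` for the sibling `C₄` line datum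
(kernel-certified expanding direction, `Theorems/FilamentSkeletonRssCoreGluingSiblingDatumHyperbolic.lean`,
p132466); only the small-separation datum `D*` is elliptic (`λ = 0.382`, p132128) — parent lead's reports
c0–c2 of stmt-15401.

This file records, kernel-checked, what the linear input can and cannot see:

* `strainedVorticityOperator_expNegQuad` — closed form of `L_λ` on an arbitrary diagonal Gaussian
  `k·exp(−(a x₀² + b x₁²))`:
  `L_λ w = w · ((4a² − (1+λ)a) x₀² + (4b² − (1−λ)b) x₁² + (1 − 2a − 2b))`;
* `strainedVorticityOperator_expNegQuad_eq_zero_iff` — CLASSIFICATION of the Gaussian steady states of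
  `L_λ` (`k ≠ 0`): `L_λ w ≡ 0` iff `4a² = (1+λ)a ∧ 4b² = (1−λ)b ∧ 2a + 2b = 1`;
* `gaussianCore_coeffs` — hence a Gaussian steady state with `a, b ≠ 0` is Gallay–Maekawa's
  `𝒢_λ`: `a = (1+λ)/4`, `b = (1−λ)/4`;
* `gaussianCore_asymmetry_lt_one` / `no_decaying_gaussianCore_of_one_le` — a Gaussian steady state
  decaying in both cross directions (`0 < a`, `0 < b`) exists only for `|λ| < 1`; for `1 ≤ λ`
  (hyperbolic or parabolic cross strain) there is NONE: at the certified skeletons there is no Gaussian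
  core to linearise at, and the hypothesis is silent (its range stops at `λ < 1`, and its weight
  `gaussWeightLam λ` is `≤ 0` there, `gaussWeightLam_nonpos_of_one_le`, so the weighted norms of the
  bound lose their meaning).

Consequence for provers of stmt-17944 (load-bearing, not a refutation): to invoke the linear input at
"the skeleton's λ" a proof must first produce ELLIPTIC supercritical skeletons with `λ_j(Γ) ≤ λ₀ < 1`
uniformly along `Γ → ∞` — information `SkeletonEquilibrium` does not export (it exports only
`N, γ, α, δ, ρ, K`); at the skeletons the route actually certified, the child is its parent `CoreGluing`
with an unusable hypothesis.

References: Th. Gallay, Y. Maekawa, arXiv:1610.08384, §4.1 (4.3)–(4.4) (`L_λ`, `𝒢_λ`, `λ ∈ [0,1)`);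
H. K. Moffatt, S. Kida, K. Ohkitani, J. Fluid Mech. 259 (1994) 241–264 (non-axisymmetric strain, `λ > 1`
has no steady solution at low Reynolds number).
-/

noncomputable section

namespace Summit.NavierStokesRegularity.NavierStokesRegularity.Theorems.CoreGluingGivenInvertibility.Negative

open Literature.Analysis.FluidPDE
open scoped Laplacian

set_option linter.dupNamespace false

section Quad

variable (a b : ℝ)

/-- `D(a y₀² + b y₁²)(x) = 2a x₀ dy₀ + 2b x₁ dy₁`. [folklore] -/
theorem hasFDerivAt_quad (x : EuclideanSpace ℝ (Fin 2)) :
    HasFDerivAt (fun y : EuclideanSpace ℝ (Fin 2) => a * y 0 ^ 2 + b * y 1 ^ 2)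
      ((a * (2 * x 0)) • (EuclideanSpace.proj 0 : EuclideanSpace ℝ (Fin 2) →L[ℝ] ℝ) +
        (b * (2 * x 1)) • (EuclideanSpace.proj 1 : EuclideanSpace ℝ (Fin 2) →L[ℝ] ℝ)) x := by
  have h0 : HasFDerivAt (fun y : EuclideanSpace ℝ (Fin 2) => y 0)
      (EuclideanSpace.proj 0 : EuclideanSpace ℝ (Fin 2) →L[ℝ] ℝ) x :=
    (EuclideanSpace.proj (0 : Fin 2) : EuclideanSpace ℝ (Fin 2) →L[ℝ] ℝ).hasFDerivAt
  have h1 : HasFDerivAt (fun y : EuclideanSpace ℝ (Fin 2) => y 1)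
      (EuclideanSpace.proj 1 : EuclideanSpace ℝ (Fin 2) →L[ℝ] ℝ) x :=
    (EuclideanSpace.proj (1 : Fin 2) : EuclideanSpace ℝ (Fin 2) →L[ℝ] ℝ).hasFDerivAt
  have h0' := (h0.pow 2).const_mul a
  have h1' := (h1.pow 2).const_mul b
  refine (h0'.add h1').congr_fderiv ?_
  ext v
  simp
  ring

/-- The diagonal Gaussian `exp(−(a y₀² + b y₁²))` and its derivative. [folklore] -/
theorem hasFDerivAt_exp_neg_quad (x : EuclideanSpace ℝ (Fin 2)) :
    HasFDerivAt (fun y : EuclideanSpace ℝ (Fin 2) => Real.exp (-(a * y 0 ^ 2 + b * y 1 ^ 2)))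
      (Real.exp (-(a * x 0 ^ 2 + b * x 1 ^ 2)) •
        -((a * (2 * x 0)) • (EuclideanSpace.proj 0 : EuclideanSpace ℝ (Fin 2) →L[ℝ] ℝ) +
          (b * (2 * x 1)) • (EuclideanSpace.proj 1 : EuclideanSpace ℝ (Fin 2) →L[ℝ] ℝ))) x :=
  (hasFDerivAt_quad a b x).neg.exp

/-- `∂₀ e^{−q} = −2a x₀ e^{−q}`. [folklore] -/
theorem fderiv_exp_neg_quad_zero (x : EuclideanSpace ℝ (Fin 2)) :
    fderiv ℝ (fun y : EuclideanSpace ℝ (Fin 2) => Real.exp (-(a * y 0 ^ 2 + b * y 1 ^ 2))) x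
      (EuclideanSpace.single 0 (1 : ℝ)) =
      -(2 * a * x 0) * Real.exp (-(a * x 0 ^ 2 + b * x 1 ^ 2)) := by
  rw [(hasFDerivAt_exp_neg_quad a b x).fderiv]
  simp
  ring

/-- `∂₁ e^{−q} = −2b x₁ e^{−q}`. [folklore] -/
theorem fderiv_exp_neg_quad_one (x : EuclideanSpace ℝ (Fin 2)) :
    fderiv ℝ (fun y : EuclideanSpace ℝ (Fin 2) => Real.exp (-(a * y 0 ^ 2 + b * y 1 ^ 2))) x
      (EuclideanSpace.single 1 (1 : ℝ)) =
      -(2 * b * x 1) * Real.exp (-(a * x 0 ^ 2 + b * x 1 ^ 2)) := by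
  rw [(hasFDerivAt_exp_neg_quad a b x).fderiv]
  simp
  ring

/-- `e^{−q}` is smooth. [folklore] -/
theorem contDiff_exp_neg_quad {n : WithTop ℕ∞} :
    ContDiff ℝ n fun y : EuclideanSpace ℝ (Fin 2) => Real.exp (-(a * y 0 ^ 2 + b * y 1 ^ 2)) :=
  Real.contDiff_exp.comp
    ((contDiff_const.mul
      ((EuclideanSpace.proj (0 : Fin 2) : EuclideanSpace ℝ (Fin 2) →L[ℝ] ℝ).contDiff.pow 2)).add
      (contDiff_const.mul
      ((EuclideanSpace.proj (1 : Fin 2) : EuclideanSpace ℝ (Fin 2) →L[ℝ] ℝ).contDiff.pow 2))).neg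

/-- `∂₀∂₀ e^{−q} = ((2a x₀)² − 2a) e^{−q}`. [folklore] -/
theorem fderiv_fderiv_exp_neg_quad_zero (x : EuclideanSpace ℝ (Fin 2)) :
    fderiv ℝ (fun y => fderiv ℝ (fun z : EuclideanSpace ℝ (Fin 2) =>
        Real.exp (-(a * z 0 ^ 2 + b * z 1 ^ 2))) y (EuclideanSpace.single 0 (1 : ℝ))) x
        (EuclideanSpace.single 0 (1 : ℝ)) =
      ((2 * a * x 0) ^ 2 - 2 * a) * Real.exp (-(a * x 0 ^ 2 + b * x 1 ^ 2)) := by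
  have hfun : (fun y => fderiv ℝ (fun z : EuclideanSpace ℝ (Fin 2) =>
      Real.exp (-(a * z 0 ^ 2 + b * z 1 ^ 2))) y (EuclideanSpace.single 0 (1 : ℝ))) =
      fun y : EuclideanSpace ℝ (Fin 2) =>
        (-(2 * a) * y 0) * Real.exp (-(a * y 0 ^ 2 + b * y 1 ^ 2)) := by
    funext y; rw [fderiv_exp_neg_quad_zero]; ring
  have hP : HasFDerivAt (fun y : EuclideanSpace ℝ (Fin 2) => -(2 * a) * y 0)
      ((-(2 * a)) • (EuclideanSpace.proj 0 : EuclideanSpace ℝ (Fin 2) →L[ℝ] ℝ)) x :=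
    (EuclideanSpace.proj (0 : Fin 2) : EuclideanSpace ℝ (Fin 2) →L[ℝ] ℝ).hasFDerivAt.const_mul _
  have h2 := (hP.mul (hasFDerivAt_exp_neg_quad a b x)).fderiv
  simp only [Pi.mul_def] at h2
  rw [hfun, h2]
  simp
  ring

/-- `∂₁∂₁ e^{−q} = ((2b x₁)² − 2b) e^{−q}`. [folklore] -/
theorem fderiv_fderiv_exp_neg_quad_one (x : EuclideanSpace ℝ (Fin 2)) :
    fderiv ℝ (fun y => fderiv ℝ (fun z : EuclideanSpace ℝ (Fin 2) =>
        Real.exp (-(a * z 0 ^ 2 + b * z 1 ^ 2))) y (EuclideanSpace.single 1 (1 : ℝ))) x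
        (EuclideanSpace.single 1 (1 : ℝ)) =
      ((2 * b * x 1) ^ 2 - 2 * b) * Real.exp (-(a * x 0 ^ 2 + b * x 1 ^ 2)) := by
  have hfun : (fun y => fderiv ℝ (fun z : EuclideanSpace ℝ (Fin 2) =>
      Real.exp (-(a * z 0 ^ 2 + b * z 1 ^ 2))) y (EuclideanSpace.single 1 (1 : ℝ))) =
      fun y : EuclideanSpace ℝ (Fin 2) =>
        (-(2 * b) * y 1) * Real.exp (-(a * y 0 ^ 2 + b * y 1 ^ 2)) := by
    funext y; rw [fderiv_exp_neg_quad_one]; ring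
  have hP : HasFDerivAt (fun y : EuclideanSpace ℝ (Fin 2) => -(2 * b) * y 1)
      ((-(2 * b)) • (EuclideanSpace.proj 1 : EuclideanSpace ℝ (Fin 2) →L[ℝ] ℝ)) x :=
    (EuclideanSpace.proj (1 : Fin 2) : EuclideanSpace ℝ (Fin 2) →L[ℝ] ℝ).hasFDerivAt.const_mul _
  have h2 := (hP.mul (hasFDerivAt_exp_neg_quad a b x)).fderiv
  simp only [Pi.mul_def] at h2
  rw [hfun, h2]
  simp
  ring

/-- `Δ e^{−q} = ((2a x₀)² + (2b x₁)² − 2a − 2b) e^{−q}`. [folklore] -/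
theorem laplacian_exp_neg_quad (x : EuclideanSpace ℝ (Fin 2)) :
    Δ (fun z : EuclideanSpace ℝ (Fin 2) => Real.exp (-(a * z 0 ^ 2 + b * z 1 ^ 2))) x =
      ((2 * a * x 0) ^ 2 + (2 * b * x 1) ^ 2 - 2 * a - 2 * b) *
        Real.exp (-(a * x 0 ^ 2 + b * x 1 ^ 2)) := by
  rw [laplacian_eq_fin_two (contDiff_exp_neg_quad a b), fderiv_fderiv_exp_neg_quad_zero,
    fderiv_fderiv_exp_neg_quad_one]
  ring

/-- **`L_λ` on an arbitrary diagonal Gaussian, closed form**: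
`L_λ (k e^{−(a x₀² + b x₁²)}) = k e^{−q} · ((4a² − (1+λ)a) x₀² + (4b² − (1−λ)b) x₁² + (1 − 2a − 2b))`.
[folklore] -/
theorem strainedVorticityOperator_expNegQuad (lam k : ℝ) (x : EuclideanSpace ℝ (Fin 2)) :
    strainedVorticityOperator lam (fun y : EuclideanSpace ℝ (Fin 2) =>
      k * Real.exp (-(a * y 0 ^ 2 + b * y 1 ^ 2))) x =
      k * Real.exp (-(a * x 0 ^ 2 + b * x 1 ^ 2)) *
        ((4 * a ^ 2 - (1 + lam) * a) * x 0 ^ 2 + (4 * b ^ 2 - (1 - lam) * b) * x 1 ^ 2 +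
          (1 - 2 * a - 2 * b)) := by
  have hc := contDiff_exp_neg_quad a b (n := 2)
  have hd : DifferentiableAt ℝ (fun y : EuclideanSpace ℝ (Fin 2) =>
      Real.exp (-(a * y 0 ^ 2 + b * y 1 ^ 2))) x :=
    (contDiff_exp_neg_quad a b (n := 1)).differentiable (by simp) x
  have hΔ : Δ (fun y : EuclideanSpace ℝ (Fin 2) =>
      k * Real.exp (-(a * y 0 ^ 2 + b * y 1 ^ 2))) x =
      k * Δ (fun y : EuclideanSpace ℝ (Fin 2) =>
        Real.exp (-(a * y 0 ^ 2 + b * y 1 ^ 2))) x := by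
    have := InnerProductSpace.laplacian_smul k (hc.contDiffAt (x := x))
    simpa [Pi.smul_def, smul_eq_mul] using this
  rw [strainedVorticityOperator, hΔ, fderiv_const_mul hd, FunLike.coe_smul, Pi.smul_apply,
    Pi.smul_apply, smul_eq_mul, smul_eq_mul, fderiv_exp_neg_quad_zero,
    fderiv_exp_neg_quad_one, laplacian_exp_neg_quad]
  ring

end Quad

/-- **Classification of the Gaussian steady states of `L_λ`.**  For `k ≠ 0`, the diagonal Gaussian
`k e^{−(a x₀² + b x₁²)}` solves `L_λ w = 0` on `ℝ²` iff
`4a² = (1+λ)a`, `4b² = (1−λ)b` and `2a + 2b = 1` (evaluate the closed form at `0`, `e₀`, `e₁`). [folklore] -/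
theorem strainedVorticityOperator_expNegQuad_eq_zero_iff {lam a b k : ℝ} (hk : k ≠ 0) :
    (∀ x, strainedVorticityOperator lam (fun y : EuclideanSpace ℝ (Fin 2) =>
        k * Real.exp (-(a * y 0 ^ 2 + b * y 1 ^ 2))) x = 0) ↔
      (4 * a ^ 2 = (1 + lam) * a ∧ 4 * b ^ 2 = (1 - lam) * b ∧ 2 * a + 2 * b = 1) := by
  constructor
  · intro h
    have hx : ∀ x : EuclideanSpace ℝ (Fin 2),
        (4 * a ^ 2 - (1 + lam) * a) * x 0 ^ 2 + (4 * b ^ 2 - (1 - lam) * b) * x 1 ^ 2 +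
          (1 - 2 * a - 2 * b) = 0 := by
      intro x
      have h1 := h x
      rw [strainedVorticityOperator_expNegQuad] at h1
      have hne : k * Real.exp (-(a * x 0 ^ 2 + b * x 1 ^ 2)) ≠ 0 :=
        mul_ne_zero hk (Real.exp_pos _).ne'
      exact (mul_eq_zero.1 h1).resolve_left hne
    have h0 := hx 0
    have he0 := hx (EuclideanSpace.single 0 (1 : ℝ))
    have he1 := hx (EuclideanSpace.single 1 (1 : ℝ))
    simp at h0 he0 he1
    refine ⟨?_, ?_, ?_⟩ <;> linarith
  · rintro ⟨ha, hb, hab⟩ x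
    rw [strainedVorticityOperator_expNegQuad]
    have : (4 * a ^ 2 - (1 + lam) * a) * x 0 ^ 2 + (4 * b ^ 2 - (1 - lam) * b) * x 1 ^ 2 +
        (1 - 2 * a - 2 * b) = 0 := by
      have h1 : 4 * a ^ 2 - (1 + lam) * a = 0 := by linarith
      have h2 : 4 * b ^ 2 - (1 - lam) * b = 0 := by linarith
      have h3 : 1 - 2 * a - 2 * b = 0 := by linarith
      rw [h1, h2, h3]; ring
    rw [this, mul_zero]

/-- **A genuinely two-dimensional Gaussian steady state of `L_λ` is Gallay–Maekawa's `𝒢_λ`.**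
If `k e^{−(a x₀² + b x₁²)}` with `k, a, b ≠ 0` solves `L_λ w = 0`, then `a = (1+λ)/4` and
`b = (1−λ)/4`. [folklore] -/
theorem gaussianCore_coeffs {lam a b k : ℝ} (hk : k ≠ 0) (ha : a ≠ 0) (hb : b ≠ 0)
    (h : ∀ x, strainedVorticityOperator lam (fun y : EuclideanSpace ℝ (Fin 2) =>
        k * Real.exp (-(a * y 0 ^ 2 + b * y 1 ^ 2))) x = 0) :
    a = (1 + lam) / 4 ∧ b = (1 - lam) / 4 := by
  obtain ⟨h1, h2, -⟩ := (strainedVorticityOperator_expNegQuad_eq_zero_iff hk).1 h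
  constructor
  · have : 4 * a = 1 + lam := mul_right_cancel₀ ha (by linarith [h1])
    linarith
  · have : 4 * b = 1 - lam := mul_right_cancel₀ hb (by linarith [h2])
    linarith

/-- **Gaussian cores exist only in the elliptic range `|λ| < 1`.**  If a diagonal Gaussian DECAYING
in both cross directions (`0 < a`, `0 < b`) solves `L_λ w = 0` with `k ≠ 0`, then `−1 < λ < 1`.
[folklore] -/
theorem gaussianCore_asymmetry_lt_one {lam a b k : ℝ} (hk : k ≠ 0) (ha : 0 < a) (hb : 0 < b)
    (h : ∀ x, strainedVorticityOperator lam (fun y : EuclideanSpace ℝ (Fin 2) =>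
        k * Real.exp (-(a * y 0 ^ 2 + b * y 1 ^ 2))) x = 0) :
    -1 < lam ∧ lam < 1 := by
  obtain ⟨h1, h2⟩ := gaussianCore_coeffs hk ha.ne' hb.ne' h
  constructor <;> linarith

/-- **No Gaussian core at hyperbolic (or parabolic) asymmetry.**  For `1 ≤ λ` — one cross direction
of the strain neutral or expanding, as at the certified supercritical skeletons (`λ = 2.16`, `1.17`) —
NO diagonal Gaussian decaying in both directions solves `L_λ w = 0`: there is no Gaussian core to
linearise at, and the crux's linear input (`λ ∈ [0,1)`) is silent. [folklore] -/
theorem no_decaying_gaussianCore_of_one_le {lam a b k : ℝ} (hlam : 1 ≤ lam) (hk : k ≠ 0)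
    (ha : 0 < a) (hb : 0 < b) :
    ¬ ∀ x, strainedVorticityOperator lam (fun y : EuclideanSpace ℝ (Fin 2) =>
        k * Real.exp (-(a * y 0 ^ 2 + b * y 1 ^ 2))) x = 0 :=
  fun h => by linarith [(gaussianCore_asymmetry_lt_one hk ha hb h).2]

/-- At the parabolic endpoint `λ = 1` the only Gaussian steady states are SHEETS: `b = 0`, `a = 1/2`
(the Burgers vortex layer `e^{−x₀²/2}`, not integrable over `ℝ²`) — or the degenerate `a = 0`, which
forces `λ = −1`. [folklore] -/
theorem gaussianCore_at_one {a b k : ℝ} (hk : k ≠ 0)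
    (h : ∀ x, strainedVorticityOperator 1 (fun y : EuclideanSpace ℝ (Fin 2) =>
        k * Real.exp (-(a * y 0 ^ 2 + b * y 1 ^ 2))) x = 0) :
    b = 0 ∧ a = 1 / 2 := by
  obtain ⟨h1, h2, h3⟩ := (strainedVorticityOperator_expNegQuad_eq_zero_iff hk).1 h
  have hb : b = 0 := by nlinarith [h2]
  exact ⟨hb, by linarith [hb, h3]⟩

/-- **The typed weight stops at the elliptic range.**  `gaussWeightLam λ = (1−λ)/(4π) e^{−(1−λ)|x|²/4}`
is `≤ 0` for `1 ≤ λ`: the weighted norms `∫ (gaussWeightLam λ)⁻¹ w²` of the linear input's bound have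
no meaning at hyperbolic asymmetry (and vanish identically at `λ = 1`). [folklore] -/
theorem gaussWeightLam_nonpos_of_one_le {lam : ℝ} (hlam : 1 ≤ lam) (x : EuclideanSpace ℝ (Fin 2)) :
    gaussWeightLam lam x ≤ 0 := by
  unfold gaussWeightLam
  have h1 : (1 - lam) / (4 * Real.pi) ≤ 0 :=
    div_nonpos_of_nonpos_of_nonneg (by linarith) (by positivity)
  exact mul_nonpos_of_nonpos_of_nonneg h1 (Real.exp_pos _).le

/-- Bookkeeping: the crux's linear input is quantified over `Set.Ico 0 1` only — it makes no claim at
any `λ ≥ 1`; combined with `no_decaying_gaussianCore_of_one_le`, a proof of the child through the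
linear input needs ELLIPTIC skeletons (`λ_j < 1` at every stagnation point, uniformly in `Γ`), which the
hypothesis `SkeletonEquilibrium` does not export. [folklore] -/
theorem coreLinearInvertibility_range {lam : ℝ} (hlam : 1 ≤ lam) : lam ∉ Set.Ico (0 : ℝ) 1 :=
  fun h => absurd h.2 (not_lt.2 hlam)

end Summit.NavierStokesRegularity.NavierStokesRegularity.Theorems.CoreGluingGivenInvertibility.Negative
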